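import Summits.BirchSwinnertonDyer.BirchSwinnertonDyer.Theses.KolyvaginRoadThree
import HarnessLib

/-!
# Route `KolyvaginRoadThree`: glue item stmt-BirchSwinnertonDyer-19576 `ZhangSharpFrameAtThreeOfHLChildren`

Cell `bsd-stepL`; planner g24's certified 1-term glue (`plan/glue/KolyvaginRoadThreeZhangSharpFrameAtThreeOfHLChildren.lean`,
rev 10 of the route, split gen 1 of `ZhangSharpFrameAtThree` into the Hoffstein–Luo child `ZhangSharpFrameAtThreeHL`
(crux 19574) and the parked off-HL complement `ZhangFrameOffHLAtThree` (19575)), filed by the hand bsd-stepL-desc3-p1 at the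
planner's 07:45Z ask. Pure logic (case split on the HL condition); THEOREM ONLY, no sorry.
-/

namespace Summit.BirchSwinnertonDyer.BirchSwinnertonDyer.Theorems

open scoped Classical in
/-- Glue item stmt-BirchSwinnertonDyer-19576 of route-BirchSwinnertonDyer-KolyvaginRoadThree (rev 10, split gen 1 of
`ZhangSharpFrameAtThree`): the HL child and the parked off-HL complement reassemble the parent frame statement by a case
split on the Hoffstein–Luo condition `ClassX11b W 3 ∧ Odd d_K ∧ L(E^{d_K},1) ≠ 0`. Pure logic. [folklore] -/
theorem kolyvaginRoadThree_zhangSharpFrameAtThreeOfHLChildren_holds :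
    Summit.BirchSwinnertonDyer.BirchSwinnertonDyer.Theses.KolyvaginRoadThree.ZhangSharpFrameAtThreeOfHLChildren := by
  intro hHL hOff W _ _ _ K _ _ Dt β ι hM hS hR ht hIQ hH hd hβ hc
  by_cases h : (Summit.BirchSwinnertonDyer.Rank1Residual.ClassX11b W 3 ∧ Odd (NumberField.discr K) ∧
      (W.quadraticTwist (NumberField.discr K : ℚ)).entireLFunction 1 ≠ 0)
  · exact hHL W K Dt β ι h.1 hM hS hR ht hIQ h.2.1 hH h.2.2 hd hβ hc
  · exact hOff W K Dt β ι h hM hS hR ht hIQ hH hd hβ hc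

end Summit.BirchSwinnertonDyer.BirchSwinnertonDyer.Theorems
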